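import Summits.BirchSwinnertonDyer.Rank1Residual.ManinAdditive.JumpDegreeLaws
import Summits.BirchSwinnertonDyer.Rank1Residual.ManinAdditive.NeronOmegaThreeTrace
import HarnessLib
import HarnessLib.Audit.Tags

/-!
# TANGENT DEFECT AT `2` FROM THE SEMISTABLE FIBRE — rows E-desc-111 / 111′ / S-desc-25 typed, assemblies PROVED (T-desc-25; typer g17)
# (desc g16 ADDENDUM, MEMO-desc §34A; cell `bsd-f2-manin`, D-0131 (3) frontier: the Manin constant at additive primes)

TYPER NOTE.  SOURCE = HOME/desc/g16/Sketch-desc-g16b.lean sha16 e87ec2ef934f04bd (245 l.; farm rc 0 · 0 err · 0 warn · 0 sorry per desc,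
check-g16b.json 01565181ee89010c), landed VERBATIM (namespace `…ManinAdditive.JumpDegree`, continuation of `JumpDegreeLaws.lean` p691457)
except for this note.  REFUTER VERDICTS AT FILING: ref1 §R120 (R-desc-25): E-desc-111 / 111′ / S-desc-25 SURVIVE, BC7 3/3 CLEAN on the
sketch, assemblies' axioms standard, THEOREM L (o)(ii)(iii) paper audit PASS; e120 reproduces 74 711 / 779 / 55 / 3 735 exactly.
bears_on: stmt-BirchSwinnertonDyer-22967 (C2 `ManinOddAtFour`, IV* sub-cells at `4 ∥ N`).

HONEST FRAMING.  Nothing E-facing is asserted.  Continuation of `JumpDegreeLaws.lean` (desc g16, §34): the same semistable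
`𝒪_L`-model of `X₀(4M)` at `2` (`L = ℚ₂^{nr}(2^{1/3})`, THEOREM J / THEOREM P of MEMO-desc §34) gives, by pure Néron bookkeeping
(LEMMA D: `e·c(A) + b = e·σ_K + a` for `A ↪ J`), a **TANGENT DEFECT**: for a curve of Kodaira type IV* at `2` with `4 ∥ N`,
the map `E ↪ J₀(N)` (dual of the modular parametrisation) is Lie-saturated at `2` **iff** some component map `φ̄_y : E_y → Ē` of
the semistable fibre at a GAUSSIAN point `y` (a supersingular point of `X₀(M)_{𝔽̄₂}` with stabiliser `C₄`, `n₂(M) = e₂(M)/2` of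
them) is separable, i.e. has ODD degree (MEMO §34A.2, THEOREM L).  Hence `σ_K ≥ 1` (NOT Lie-saturated) whenever
(i) some prime `q ≡ 3 (mod 4)` divides `N` (no Gaussian points: **E-desc-111**), or (ii) `E[2]` is irreducible and `M = p^a`,
`p ≡ 1 (mod 4)` (one Gaussian point; its degree has the parity of `deg φ`, which is even by [Calegari–Emerton 2009, Thm. 1]:
**E-desc-111′**).  With the GIVEN row `IsConwayNeronAtTwo` (print-backed at `v₂(N) = 2`, ConwayCut) the Conway defect
`δ = ord₂ deg φ − ord₂ r_G` equals `σ_K + ord₂ c_E`; so on these two sub-cells the E-BLIND number `δ` CERTIFIES Manin at 2: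
`δ ≤ 1 ⟹ 2 ∤ c_E` (assemblies below, PROVED from the tree's glue
`NeronOmegaThree.not_dvd_maninConstant_of_shallowByOne_of_not_lieSaturated`).  This is the `p = 2` counterpart of imc's
tangent-defect lever (E-imc-157R at `p = 3`), with the difference that the crux «not Lie-saturated» is here a THEOREM-CANDIDATE
with a proof route independent of `c_E` (REF1 §R90 found E-imc-157R ⟺ `3 ∤ c_E` on its class, a reformulation; E-desc-111 is
not: its proof is THEOREM P + LEMMA D, no Manin input).
BC5 (falsifier run, MEMO §34A.4): MS-0 (desc g6, `4 ∣ N ≤ 612`) IV* rows at `4 ∥ N`: non-Gaussian levels 39/39 `δ = 1`, no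
2-torsion; Gaussian `N = 4p`: 8/8 irreducible `δ = 1`, 4/4 reducible (`20a1, 52a1, 116c1, 212b1` = the `4(s²+4)` family) `δ = 0`;
engine-2 (data seat, SIGMA-rows-v2-part1, levels to 1108): 34/34, 12/12, 6/6 likewise (adds `628a1, 676b1, 676c1, 1108a1`; `692a1,
916a1` family).  Every IV* row with a computed `δ` (47 + 6 new) is covered by (i) or (ii); the first rows OUTSIDE both are the
irreducible IV* optimal curves at Gaussian levels with `n₂(M) ≥ 2` (`740a1, 740b1, 740c1, 1060a1, 1300a1, …`; 1 634 with
`N < 2·10⁵`), where THEOREM L allows `σ_K = 0` iff the (`w`-conjugate, equal) Gaussian component degrees are odd — data ask D-desc-22.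
PARTITION (desc): frontier-data → ladder-adjacent · beyond-print theorem: YES on paper (THEOREM L), no in Lean · `2 ∤ c_E` is NOT
proved by this; BSD is not proved by this; Manin's conjecture is not proved by this.  bears_on: stmt-BirchSwinnertonDyer-22967 (C2).
-/

noncomputable section

open scoped MatrixGroups ModularForm

open CongruenceSubgroup WeierstrassCurve Literature.NumberTheory.EllipticCurves.ModularForms

open Summit.BirchSwinnertonDyer.Rank1Residual.ManinAdditive
  Summit.BirchSwinnertonDyer.Rank1Residual.ManinAdditive.ConwayCut
  Summit.BirchSwinnertonDyer.Rank1Residual.ManinAdditive.NeronOmegaThree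

namespace Summit.BirchSwinnertonDyer.Rank1Residual.ManinAdditive.JumpDegree

/-! ### §5. Gaussian prime-power levels (`n₂(M) = 1`) -/

/-- `N = 4·p^a` with `p ≡ 1 (mod 4)` prime and `a ≥ 1`: the levels `4M`, `M` odd, whose supersingular locus over `𝔽̄₂` carries
EXACTLY ONE Gaussian point (`n₂(M) = e₂(M)/2 = 1`, MEMO-desc §34.2). -/
def IsGaussianPrimePowerLevel (N : ℕ) : Prop :=
  ∃ p a : ℕ, p.Prime ∧ p % 4 = 1 ∧ 0 < a ∧ N = 4 * p ^ a

/-- A Gaussian prime-power level has all odd prime factors `≡ 1 (mod 4)` (so it is a Gaussian level in the sense of §34). -/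
theorem allOddPrimeFactorsOneModFour_of_isGaussianPrimePowerLevel {N : ℕ} (h : IsGaussianPrimePowerLevel N) :
    AllOddPrimeFactorsOneModFour N := by
  obtain ⟨p, a, hp, hp4, _, rfl⟩ := h
  intro q hq hqN hq2
  have h4 : (4 : ℕ) = 2 ^ 2 := by norm_num
  rcases (Nat.Prime.dvd_mul hq).mp hqN with h | h
  · rw [h4] at h
    exact absurd (((Nat.prime_dvd_prime_iff_eq hq Nat.prime_two).mp (hq.dvd_of_dvd_pow h))) hq2
  · rw [(Nat.prime_dvd_prime_iff_eq hq hp).mp (hq.dvd_of_dvd_pow h)]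
    exact hp4

/-- Example: `116 = 4·29` (curves 116a1, 116b1: IV*, `E[2]` irreducible, `δ = 1`; 116c1: the family curve, `δ = 0`). -/
theorem isGaussianPrimePowerLevel_116 : IsGaussianPrimePowerLevel 116 :=
  ⟨29, 1, by norm_num, by norm_num, by norm_num, by norm_num⟩

/-- Example: `676 = 4·13²` (676b1, 676c1: IV*, irreducible, `δ = 1`, engine-2). -/
theorem isGaussianPrimePowerLevel_676 : IsGaussianPrimePowerLevel 676 :=
  ⟨13, 2, by norm_num, by norm_num, by norm_num, by norm_num⟩

/-! ### §6. Elementary consequences of the tame IV* typing -/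

/-- IV* on the tame cell is a starred type (`v₂(Δ) = 8 ≥ v₂(N) + 4 = 6`). -/
theorem isStarredAtTwo_of_fourStarTame {W : WeierstrassCurve ℚ} (h : IsTypeFourStarAtTwoTame W) : IsStarredAtTwo W := by
  unfold IsStarredAtTwo
  rw [h.1, h.2]
  norm_num

/-- IV* on the tame cell is not I₀* (`v₂(Δ) = 8 ≠ 6`). -/
theorem not_isTypeIZeroStarAtTwo_of_fourStarTame {W : WeierstrassCurve ℚ} (h : IsTypeFourStarAtTwoTame W) :
    ¬ IsTypeIZeroStarAtTwo W := by
  unfold IsTypeIZeroStarAtTwo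
  rw [h.1, h.2]
  norm_num

/-- On the tame cell `4 ∣ N`. -/
theorem four_dvd_of_fourStarTame {W : WeierstrassCurve ℚ} (h : IsTypeFourStarAtTwoTame W) : 4 ∣ W.conductorNorm ℤ := by
  have h2 : 2 ^ padicValNat 2 (W.conductorNorm ℤ) ∣ W.conductorNorm ℤ := pow_padicValNat_dvd
  rw [h.1] at h2
  simpa using h2

/-! ### §7. The candidate rows (nothing asserted) -/

/-- **Candidate E-desc-111 `FourStarTangentDefectLaw`** (cell bsd-f2-manin, desc g16 addendum, MEMO-desc §34A; THEOREM-CANDIDATE on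
paper = THEOREM L (i); nothing asserted): for an optimal curve with Kodaira type IV* at `2`, `4 ∥ N`, at a level with a prime factor
`q ≡ 3 (mod 4)`, whose Néron `f`-line datum satisfies the GIVEN row `IsConwayNeronAtTwo`, the map `E ↪ J₀(N)` is NOT Lie-saturated
at `2` (every Néron differential of `J₀(N)` pulls back into `2ℤ·ω`).  PROOF ROUTE (paper): the semistable `𝒪_L`-fibre of `X₀(N)`
has no Gaussian component (`e₂(N/4) = 0`), so every exceptional component map `φ̄_y : E_y → Ē` is `μ₃`-anti-equivariant, hence
inseparable or zero (THEOREM P), hence `φ̄^* : Ē → Pic⁰(X_s)` kills `α₂` and has zero differential (`Hom(α₂, T) = 0` for the toric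
part), i.e. `b ≥ 1` in LEMMA D `2 + b = 3σ_K + a` with `a ≤ 2`, so `σ_K ≥ 1`; the GIVEN row transports `σ_K` to the datum.
BC5: MS-0 39/39 + engine-2 34/34 IV* rows at non-Gaussian `4 ∥ N` levels have Conway defect `δ = 1` (so `σ_K = 1`, `c_E` odd there).
Why it might fail: only through an error in THEOREM P's component analysis (old components contracted, exceptional components =
the `n₁` generic supersingular points) — e.g. an exceptional component of the semistable fibre NOT of the form `E_y` at a level where
`X₀(M)_{𝔽̄₂}` has a supersingular point with stabiliser `SL₂(𝔽₃)` (`M = 1`; excluded since `M ≥ 3` here).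
[cite: Edixhoven1990, Thm. 2.1.2 (p. 55) (shape only: semistable reduction of `X₀` at a tame additive prime; the tangent-defect law is the cell's row E-desc-111, NOT in print — MEMO-desc §34A)] -/
@[conjecture]
def FourStarTangentDefectLaw : Prop :=
  ∀ (W : WeierstrassCurve ℚ) [W.IsElliptic] [W.IsGloballyMinimal] [NeZero (W.conductorNorm ℤ)]
    (D : ModularParametrizationData W (W.conductorNorm ℤ)) (Δ : NeronFLineDatum W D),
    (∀ z ∈ D.L.lattice, ∃ w ∈ periodLattice D.f, z = D.c * w) →
    (∀ (W' : WeierstrassCurve ℚ) [W'.IsElliptic]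
        (D' : ModularParametrizationData W' (W.conductorNorm ℤ)),
        D'.f = D.f → D.modularDegree ≤ D'.modularDegree) →
    IsConwayNeronAtTwo Δ → IsTypeFourStarAtTwoTame W → HasPrimeFactorThreeModFour (W.conductorNorm ℤ) →
      ¬ Δ.LieSaturatedAt 2

/-- **Candidate E-desc-111′ `FourStarTangentDefectLawPrimePower`** (THEOREM-CANDIDATE on paper = THEOREM L (ii); nothing asserted):
the same conclusion at the Gaussian prime-power levels `N = 4p^a`, `p ≡ 1 (mod 4)`, for curves WITHOUT rational 2-torsion.
PROOF ROUTE (paper): exactly one Gaussian component `E_{y₀}`; all other component maps are inseparable or zero (THEOREM P), so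
`deg φ ≡ deg φ̄_{y₀} (mod 2)`; `deg φ` is even by [Calegari–Emerton 2009, Thm. 1] (odd modular degree at `4 ∣ N` forces a rational
point of order 2); so `φ̄_{y₀}` is inseparable too, `b ≥ 1`, `σ_K ≥ 1`.  BC5: MS-0 8/8 (`116a1, 116b1, 148a1, 212a1, 244a1, 356a1,
404a1, 404b1`) + engine-2 12/12 (adds `628a1, 676b1, 676c1, 1108a1`) have `δ = 1`; the 2-torsion rows at these levels (`20a1, 52a1,
116c1, 212b1, 692a1, 916a1`, the `4(s²+4)` family, odd `deg φ`) have `δ = 0` — the hypothesis `¬ HasRationalTwoTorsion` is sharp.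
Why it might fail: as E-desc-111; the parity input is a theorem in print.
[cite: CalegariEmerton2009, Thm. 1 (odd modular degree ⟹ rational 2-torsion, or prime conductor, or CM with N ∈ {27,32,49,243}) (shape only: the parity input; the law is the cell's row E-desc-111′, NOT in print — MEMO-desc §34A)] -/
@[conjecture]
def FourStarTangentDefectLawPrimePower : Prop :=
  ∀ (W : WeierstrassCurve ℚ) [W.IsElliptic] [W.IsGloballyMinimal] [NeZero (W.conductorNorm ℤ)]
    (D : ModularParametrizationData W (W.conductorNorm ℤ)) (Δ : NeronFLineDatum W D),
    (∀ z ∈ D.L.lattice, ∃ w ∈ periodLattice D.f, z = D.c * w) →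
    (∀ (W' : WeierstrassCurve ℚ) [W'.IsElliptic]
        (D' : ModularParametrizationData W' (W.conductorNorm ℤ)),
        D'.f = D.f → D.modularDegree ≤ D'.modularDegree) →
    IsConwayNeronAtTwo Δ → IsTypeFourStarAtTwoTame W → ¬ HasRationalTwoTorsion W →
    IsGaussianPrimePowerLevel (W.conductorNorm ℤ) →
      ¬ Δ.LieSaturatedAt 2

/-- **Support S-desc-25 `ShallowByOneTransferAtTwo`** (finite-index lattice bookkeeping, the `p = 2` twin of E-imc-158; TRUE on paper,
not proved here; nothing asserted): the GIVEN row `Λ ⊗ ℤ₍₂₎ = S^G ⊗ ℤ₍₂₎` + the E-blind bound «Conway defect `≤ 1`» (as the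
`lineIndex` inequality) ⇒ a shallow-by-one witness inside `Λ`. -/
@[conjecture]
def ShallowByOneTransferAtTwo : Prop :=
  ∀ (N : ℕ) [NeZero N] (W : WeierstrassCurve ℚ) [W.IsElliptic] (D : ModularParametrizationData W N)
    (Δ : NeronFLineDatum W D), 4 ∣ N → IsConwayNeronAtTwo Δ →
    padicValNat 2 D.modularDegree ≤ padicValNat 2 (lineIndex (conwayStableLattice N) D.f) + 1 →
    lineIndex (conwayStableLattice N) D.f ≠ 0 → HasShallowByOneWitnessAt Δ 2

/-! ### §8. Assemblies (PROVED modulo the named rows): the E-blind Manin certificate «`δ ≤ 1`» on the two IV* sub-cells -/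

/-- **CERTIFICATE (i)** (PROVED from E-desc-111 + S-desc-25 + the tree's glue): on the IV* / non-Gaussian sub-cell, the E-blind
inequality «Conway defect `≤ 1`» certifies `2 ∤ c_E` — no input from Cremona's table. -/
theorem not_two_dvd_maninConstant_of_fourStar_nonGaussian
    (h111 : FourStarTangentDefectLaw) (hS : ShallowByOneTransferAtTwo)
    (W : WeierstrassCurve ℚ) [W.IsElliptic] [W.IsGloballyMinimal] [NeZero (W.conductorNorm ℤ)]
    (D : ModularParametrizationData W (W.conductorNorm ℤ)) (Δ : NeronFLineDatum W D)
    (hL : ∀ z ∈ D.L.lattice, ∃ w ∈ periodLattice D.f, z = D.c * w)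
    (hopt : ∀ (W' : WeierstrassCurve ℚ) [W'.IsElliptic]
        (D' : ModularParametrizationData W' (W.conductorNorm ℤ)),
        D'.f = D.f → D.modularDegree ≤ D'.modularDegree)
    (hΛ : IsConwayNeronAtTwo Δ) (hIV : IsTypeFourStarAtTwoTame W) (hq : HasPrimeFactorThreeModFour (W.conductorNorm ℤ))
    (hδ : padicValNat 2 D.modularDegree ≤ padicValNat 2 (lineIndex (conwayStableLattice (W.conductorNorm ℤ)) D.f) + 1)
    (hfin : lineIndex (conwayStableLattice (W.conductorNorm ℤ)) D.f ≠ 0) :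
    ¬ (2 : ℤ) ∣ D.maninConstant :=
  haveI : Fact (Nat.Prime 2) := ⟨Nat.prime_two⟩
  not_dvd_maninConstant_of_shallowByOne_of_not_lieSaturated Δ
    (hS _ W D Δ (four_dvd_of_fourStarTame hIV) hΛ hδ hfin) (h111 W D Δ hL hopt hΛ hIV hq)

/-- **CERTIFICATE (ii)** (PROVED from E-desc-111′ + S-desc-25 + glue): the same at the Gaussian prime-power levels for curves without
rational 2-torsion. -/
theorem not_two_dvd_maninConstant_of_fourStar_primePower
    (h111' : FourStarTangentDefectLawPrimePower) (hS : ShallowByOneTransferAtTwo)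
    (W : WeierstrassCurve ℚ) [W.IsElliptic] [W.IsGloballyMinimal] [NeZero (W.conductorNorm ℤ)]
    (D : ModularParametrizationData W (W.conductorNorm ℤ)) (Δ : NeronFLineDatum W D)
    (hL : ∀ z ∈ D.L.lattice, ∃ w ∈ periodLattice D.f, z = D.c * w)
    (hopt : ∀ (W' : WeierstrassCurve ℚ) [W'.IsElliptic]
        (D' : ModularParametrizationData W' (W.conductorNorm ℤ)),
        D'.f = D.f → D.modularDegree ≤ D'.modularDegree)
    (hΛ : IsConwayNeronAtTwo Δ) (hIV : IsTypeFourStarAtTwoTame W) (ht : ¬ HasRationalTwoTorsion W)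
    (hN : IsGaussianPrimePowerLevel (W.conductorNorm ℤ))
    (hδ : padicValNat 2 D.modularDegree ≤ padicValNat 2 (lineIndex (conwayStableLattice (W.conductorNorm ℤ)) D.f) + 1)
    (hfin : lineIndex (conwayStableLattice (W.conductorNorm ℤ)) D.f ≠ 0) :
    ¬ (2 : ℤ) ∣ D.maninConstant :=
  haveI : Fact (Nat.Prime 2) := ⟨Nat.prime_two⟩
  not_dvd_maninConstant_of_shallowByOne_of_not_lieSaturated Δ
    (hS _ W D Δ (four_dvd_of_fourStarTame hIV) hΛ hδ hfin) (h111' W D Δ hL hopt hΛ hIV ht hN)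

/-- **CHAIN with the cell's law E-desc-41** (PROVED modulo the named rows): `StarredConwayDefectLaw` (E-blind LAW: Conway defect EXACTLY
one for starred, non-I₀*, 2-torsion-free curves) supplies `δ = 1`, so E-41 + E-111 + S-desc-25 + GIVEN ⇒ `2 ∤ c_E` for every
2-torsion-free optimal IV* curve at a `4 ∥ N` level with a prime factor `≡ 3 (mod 4)` (74 711 optimal curves with `N < 5·10⁵`). -/
theorem not_two_dvd_maninConstant_of_fourStar_laws
    (h41 : StarredConwayDefectLaw) (h111 : FourStarTangentDefectLaw) (hS : ShallowByOneTransferAtTwo)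
    (W : WeierstrassCurve ℚ) [W.IsElliptic] [W.IsGloballyMinimal] [NeZero (W.conductorNorm ℤ)]
    (D : ModularParametrizationData W (W.conductorNorm ℤ)) (Δ : NeronFLineDatum W D)
    (hL : ∀ z ∈ D.L.lattice, ∃ w ∈ periodLattice D.f, z = D.c * w)
    (hopt : ∀ (W' : WeierstrassCurve ℚ) [W'.IsElliptic]
        (D' : ModularParametrizationData W' (W.conductorNorm ℤ)),
        D'.f = D.f → D.modularDegree ≤ D'.modularDegree)
    (hΛ : IsConwayNeronAtTwo Δ) (hIV : IsTypeFourStarAtTwoTame W) (ht : ¬ HasRationalTwoTorsion W)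
    (hq : HasPrimeFactorThreeModFour (W.conductorNorm ℤ))
    (hfin : lineIndex (conwayStableLattice (W.conductorNorm ℤ)) D.f ≠ 0) :
    ¬ (2 : ℤ) ∣ D.maninConstant := by
  have hδ := h41 W D hL hopt (four_dvd_of_fourStarTame hIV) (isStarredAtTwo_of_fourStarTame hIV)
    (not_isTypeIZeroStarAtTwo_of_fourStarTame hIV) ht
  exact not_two_dvd_maninConstant_of_fourStar_nonGaussian h111 hS W D Δ hL hopt hΛ hIV hq (by omega) hfin

/-- … and the prime-power twin (E-41 + E-111′ + S-desc-25 + GIVEN ⇒ `2 ∤ c_E` at `N = 4p^a`, `p ≡ 1 (4)`, no rational 2-torsion). -/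
theorem not_two_dvd_maninConstant_of_fourStar_laws_primePower
    (h41 : StarredConwayDefectLaw) (h111' : FourStarTangentDefectLawPrimePower) (hS : ShallowByOneTransferAtTwo)
    (W : WeierstrassCurve ℚ) [W.IsElliptic] [W.IsGloballyMinimal] [NeZero (W.conductorNorm ℤ)]
    (D : ModularParametrizationData W (W.conductorNorm ℤ)) (Δ : NeronFLineDatum W D)
    (hL : ∀ z ∈ D.L.lattice, ∃ w ∈ periodLattice D.f, z = D.c * w)
    (hopt : ∀ (W' : WeierstrassCurve ℚ) [W'.IsElliptic]
        (D' : ModularParametrizationData W' (W.conductorNorm ℤ)),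
        D'.f = D.f → D.modularDegree ≤ D'.modularDegree)
    (hΛ : IsConwayNeronAtTwo Δ) (hIV : IsTypeFourStarAtTwoTame W) (ht : ¬ HasRationalTwoTorsion W)
    (hN : IsGaussianPrimePowerLevel (W.conductorNorm ℤ))
    (hfin : lineIndex (conwayStableLattice (W.conductorNorm ℤ)) D.f ≠ 0) :
    ¬ (2 : ℤ) ∣ D.maninConstant := by
  have hδ := h41 W D hL hopt (four_dvd_of_fourStarTame hIV) (isStarredAtTwo_of_fourStarTame hIV)
    (not_isTypeIZeroStarAtTwo_of_fourStarTame hIV) ht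
  exact not_two_dvd_maninConstant_of_fourStar_primePower h111' hS W D Δ hL hopt hΛ hIV ht hN (by omega) hfin

/-- The two tangent-defect rows cover EVERY optimal IV* curve at `4 ∥ N` with no rational 2-torsion whose level is non-Gaussian or a
Gaussian prime power — as one statement (PROVED bookkeeping): outside lie only the Gaussian levels with `n₂(M) ≥ 2`. -/
theorem not_lieSaturatedAt_two_of_fourStar_rows
    (h111 : FourStarTangentDefectLaw) (h111' : FourStarTangentDefectLawPrimePower)
    (W : WeierstrassCurve ℚ) [W.IsElliptic] [W.IsGloballyMinimal] [NeZero (W.conductorNorm ℤ)]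
    (D : ModularParametrizationData W (W.conductorNorm ℤ)) (Δ : NeronFLineDatum W D)
    (hL : ∀ z ∈ D.L.lattice, ∃ w ∈ periodLattice D.f, z = D.c * w)
    (hopt : ∀ (W' : WeierstrassCurve ℚ) [W'.IsElliptic]
        (D' : ModularParametrizationData W' (W.conductorNorm ℤ)),
        D'.f = D.f → D.modularDegree ≤ D'.modularDegree)
    (hΛ : IsConwayNeronAtTwo Δ) (hIV : IsTypeFourStarAtTwoTame W) (ht : ¬ HasRationalTwoTorsion W)
    (hN : HasPrimeFactorThreeModFour (W.conductorNorm ℤ) ∨ IsGaussianPrimePowerLevel (W.conductorNorm ℤ)) :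
    ¬ Δ.LieSaturatedAt 2 := by
  rcases hN with hq | hpp
  · exact h111 W D Δ hL hopt hΛ hIV hq
  · exact h111' W D Δ hL hopt hΛ hIV ht hpp

end Summit.BirchSwinnertonDyer.Rank1Residual.ManinAdditive.JumpDegree

end
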